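import Summits.BirchSwinnertonDyer.BirchSwinnertonDyer.Theorems.EdixhovenFibreFiveSevenStarredOptimalManinUnitFiveSevenDualExpOuterGalois
import HarnessLib

/-!
# `exp*_ω` on `H¹(F, V_pE)` is equivariant under `Gal(F/F₀)` for a generator `ω` coming from `F₀`
# (route `EdixhovenFibreFiveSeven`, crux K★ `StarredOptimalManinUnitFiveSeven` stmt-BirchSwinnertonDyer-22226, line `kato-lever`, G5 by Galois descent)

HONEST FRAMING. Theorems only (no definition, no named fact, no `sorry`, no instance); `--supports` 22226 (helper); nothing is
closed; BSD / K★ / [REC-tower] are NOT proved by this file. Sequel of `…DualExpOuterGalois` (`exists_filZeroLine_expStarCoord_outerConj`: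
`exp*_{ω''}(Conj η) = g(exp*_ω η)` for a TRANSPORTED generator `ω''`).

Setting: a tower `K₀ ⊆ F₀ ⊆ F` (`F₀`, `F` `p`-adic fields), `g ∈ Aut(F/F₀)` with an `F₀`-linear lift `ĝ` (`ĝ ∘ ι = ι ∘ γ₀` on `F̄₀`,
`γ₀ ∈ Γ_{F₀}`), the outer datum `(α, τ)` of `ĝ` and an embedding element `τ₀` of the tower (`ι ∘ j₀ = j_F ∘ τ₀`), `Res = «pull back along
res_{F/F₀}, apply T(τ₀)»`, `Conj = «pull back along α⁻¹, apply T(τ)»`.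

* §1 `exists_algEquiv_lift_inner` — every `g ∈ Aut(F/F₀)` has a lift `ĝ : F̄ ≃ₐ[K₀] F̄` TOGETHER with `γ₀ ∈ Γ_{F₀}`, `ĝ ∘ ι = ι ∘ γ₀`.
* §2 `absGaloisRestrict_outerConj_symm` (`res_{F/F₀}(α⁻¹σ) = γ₀⁻¹ · res_{F/F₀}(σ) · γ₀`), `outerEmb_mul_towerEmb` (`τ τ₀ = τ₀ · res_{F₀/K₀}(γ₀)`),
  `algEquiv_algebraMap_of_inner` (`g|_{F₀} = id`).
* §3 `expStarCoord_innerConj` — INNER conjugation by `γ₀` does not change `exp*` over `F₀` (the conjugated cocycle is cohomologous: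
  `T(γ₀) η₀(γ₀⁻¹ s γ₀) = η₀(s) + (s − 1) η₀(γ₀)`); `outerConj_res_eq_res_innerConj` (`Conj (Res η₀) = Res (γ₀ · η₀)` on the nose).
* §4 ★★ `expStarCoord_outerConj` — **if `exp*_ω ∘ Res = (F₀ → F) ∘ exp*_{ω₀}` (hT₂'s compatibility clause, i.e. `ω` comes from a generator
  `ω₀` over `F₀`) and `exp*_{ω₀} ≢ 0`, then `exp*_ω(Conj η) = g(exp*_ω(η))` for EVERY `η ∈ Z¹(Γ_F, T_pW|_{Γ_F})`**: the transported generator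
  `ω''` of the prequel is `λ ω`; evaluating both sides at `Res η₀` with `exp*_{ω₀}(η₀) ≠ 0` (where `Conj` acts through the inner `γ₀`, §3,
  and `g` fixes `F₀`) forces `λ = 1`.

## References
* K. Kato, LNM 1553 (1993), Ch. II §1.2.4 (functoriality of `exp*`), Prop. 1.2.3. [Kato1993LNM1553]
* J.-P. Serre, *Galois Cohomology* (1997), I §2.4 (compatible pairs), I §5.8 (inner automorphisms act trivially on `H¹`). [SerreGaloisCohomology1997]
-/

set_option autoImplicit false
-- the Theorems namespace of a single-conjunct summit repeats the summit name by design (D-0017)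
set_option linter.dupNamespace false

noncomputable section

open scoped TensorProduct
open Field ValuativeRel Function WittVector
open Literature.NumberTheory.GaloisRepresentations
open Literature.NumberTheory.GaloisRepresentations.PeriodRingData
open Literature.NumberTheory.PAdicHodge
open Literature.NumberTheory.EllipticCurves _root_.WeierstrassCurve
open Summit.BirchSwinnertonDyer.BirchSwinnertonDyer.Theorems.StarredOptimalManinUnitFiveSevenDualExpOuterGalois

namespace Summit.BirchSwinnertonDyer.BirchSwinnertonDyer.Theorems.StarredOptimalManinUnitFiveSevenDualExpOuterGaloisInvariant

variable {K₀ : Type} [Field K₀] [CharZero K₀] (W : WeierstrassCurve K₀) [W.IsElliptic]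
  (F₀ : Type) [Field F₀] [Algebra K₀ F₀]
  (F : Type) [Field F] [Algebra K₀ F] [Algebra F₀ F] [IsScalarTower K₀ F₀ F]
  (p : ℕ) [Fact p.Prime]

/-! ### §1 Lifts of `Aut(F/F₀)` together with their inner element on `F̄₀` -/

omit [CharZero K₀] in
/-- **Every `g ∈ Aut(F/F₀)` (`F/F₀` algebraic) lifts to `ĝ : F̄ ≃ₐ[K₀] F̄` with `ĝ|_F = g` AND `ĝ ∘ ι = ι ∘ γ₀` for some `γ₀ ∈ Γ_{F₀}`**
(`ι : F̄₀ → F̄` the chosen `F₀`-embedding): the `F₀`-linear lift `g.liftNormal F̄` composed with `ι` is another `F₀`-embedding `F̄₀ → F̄`, hence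
`ι ∘ γ₀` (tree `exists_absClosureEmbedding_comp_eq`). [cite: MilneFT2022, Ch. 7 (extension of automorphisms; the absolute Galois group up to inner automorphism)] -/
theorem exists_algEquiv_lift_inner [Algebra.IsAlgebraic F₀ F] (g : F ≃ₐ[F₀] F) :
    ∃ ĝ : AlgebraicClosure F ≃ₐ[K₀] AlgebraicClosure F,
      (∀ c : F, ĝ (algebraMap F (AlgebraicClosure F) c) = algebraMap F (AlgebraicClosure F) (g c)) ∧
      ∃ γ₀ : absoluteGaloisGroup F₀, ∀ y : AlgebraicClosure F₀,
        ĝ (absClosureEmbedding F₀ F y) = absClosureEmbedding F₀ F (γ₀ • y) := by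
  haveI : Algebra.IsAlgebraic F₀ (AlgebraicClosure F) := Algebra.IsAlgebraic.trans F₀ F (AlgebraicClosure F)
  haveI : IsAlgClosure F₀ (AlgebraicClosure F) := { isAlgClosed := inferInstance, isAlgebraic := inferInstance }
  obtain ⟨γ₀, hγ₀⟩ := exists_absClosureEmbedding_comp_eq F₀ F
    ((g.liftNormal (AlgebraicClosure F) : AlgebraicClosure F →ₐ[F₀] AlgebraicClosure F).comp (absClosureEmbedding F₀ F))
  exact ⟨(g.liftNormal (AlgebraicClosure F)).restrictScalars K₀, fun c => g.liftNormal_commutes (AlgebraicClosure F) c,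
    γ₀, fun y => (hγ₀ y).symm⟩

/-! ### §2 Bookkeeping of the outer datum against the tower -/

section Bookkeeping

variable (g : F ≃ₐ[K₀] F) (ĝ : AlgebraicClosure F ≃ₐ[K₀] AlgebraicClosure F)
  (hĝ : ∀ c : F, ĝ (algebraMap F (AlgebraicClosure F) c) = algebraMap F (AlgebraicClosure F) (g c))
  {α : absoluteGaloisGroup F ≃ₜ* absoluteGaloisGroup F}
  (hα : ∀ (σ : absoluteGaloisGroup F) (x : AlgebraicClosure F), α σ • ĝ x = ĝ (σ • x))
  {τ : absoluteGaloisGroup K₀}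
  (hτ : ∀ x : AlgebraicClosure K₀, absClosureEmbedding K₀ F (τ • x) = ĝ (absClosureEmbedding K₀ F x))
  {γ₀ : absoluteGaloisGroup F₀}
  (hγ₀ : ∀ y : AlgebraicClosure F₀, ĝ (absClosureEmbedding F₀ F y) = absClosureEmbedding F₀ F (γ₀ • y))
  {τ₀ : absoluteGaloisGroup K₀}
  (hτ₀ : ∀ x : AlgebraicClosure K₀, absClosureEmbedding F₀ F (absClosureEmbedding K₀ F₀ x) = absClosureEmbedding K₀ F (τ₀ • x))

omit [CharZero K₀] [IsScalarTower K₀ F₀ F] [Algebra K₀ F₀] in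
include hα hγ₀ in
/-- **`res_{F/F₀}(α⁻¹ σ) = γ₀⁻¹ · res_{F/F₀}(σ) · γ₀`**: on `F̄₀` (through `ι`) both act as `y ↦ ĝ⁻¹(σ(ĝ(ι y)))`.
[cite: SerreGaloisCohomology1997, I §2.4 (compatible pairs)] -/
theorem absGaloisRestrict_outerConj_symm (σ : absoluteGaloisGroup F) :
    absGaloisRestrict F₀ F (α.symm σ) = γ₀⁻¹ * absGaloisRestrict F₀ F σ * γ₀ := by
  refine FaithfulSMul.eq_of_smul_eq_smul (α := AlgebraicClosure F₀) fun y => ?_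
  apply (absClosureEmbedding F₀ F).toRingHom.injective
  apply ĝ.injective
  change ĝ (absClosureEmbedding F₀ F (absGaloisRestrict F₀ F (α.symm σ) • y)) =
    ĝ (absClosureEmbedding F₀ F ((γ₀⁻¹ * absGaloisRestrict F₀ F σ * γ₀) • y))
  rw [absGaloisRestrict_apply_smul, outerConj_symm_smul F ĝ hα, hγ₀, mul_smul, mul_smul, hγ₀, smul_inv_smul,
    absGaloisRestrict_apply_smul]

omit [CharZero K₀] [IsScalarTower K₀ F₀ F] in
include hτ hγ₀ hτ₀ in
/-- **`τ · τ₀ = τ₀ · res_{F₀/K₀}(γ₀)`** in `Γ_{K₀}`: on `K̄₀` (through `j_F`) both act as `x ↦ ĝ(ι(j₀ x))`.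
[cite: SerreGaloisCohomology1997, I §2.4 (compatible pairs)] [cite: MilneFT2022, Ch. 7, footnote after Prop. 7.6] -/
theorem outerEmb_mul_towerEmb : τ * τ₀ = τ₀ * absGaloisRestrict K₀ F₀ γ₀ := by
  refine FaithfulSMul.eq_of_smul_eq_smul (α := AlgebraicClosure K₀) fun x => ?_
  apply (absClosureEmbedding K₀ F).toRingHom.injective
  change absClosureEmbedding K₀ F ((τ * τ₀) • x) = absClosureEmbedding K₀ F ((τ₀ * absGaloisRestrict K₀ F₀ γ₀) • x)
  rw [mul_smul, mul_smul, hτ, ← hτ₀, hγ₀, ← absGaloisRestrict_apply_smul, hτ₀]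

omit [CharZero K₀] [Algebra K₀ F₀] [IsScalarTower K₀ F₀ F] in
include hĝ hγ₀ in
/-- **`g` fixes `F₀`**: `g (c|_F) = c|_F` for `c ∈ F₀` (as `ĝ ∘ ι = ι ∘ γ₀` and `γ₀` fixes `F₀`). [cite: MilneFT2022, Ch. 7] -/
theorem algEquiv_algebraMap_of_inner (c : F₀) : g (algebraMap F₀ F c) = algebraMap F₀ F c := by
  apply (algebraMap F (AlgebraicClosure F)).injective
  rw [← hĝ, IsScalarTower.algebraMap_apply F₀ F (AlgebraicClosure F) c |>.symm.trans
    ((absClosureEmbedding F₀ F).commutes c).symm, hγ₀, absoluteGaloisGroup.smul_def, AlgEquiv.commutes]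

end Bookkeeping

/-! ### §3 Inner conjugation on `Z¹(Γ_{F₀}, T_pW)` and the outer conjugation of restricted cocycles -/

section Inner

variable (γ₀ : absoluteGaloisGroup F₀)

omit [CharZero K₀] [W.IsElliptic] in
/-- The compatible-pair relation of the INNER conjugation `s ↦ γ₀⁻¹ s γ₀` with `T(res_{F₀/K₀} γ₀)`. [cite: SerreGaloisCohomology1997, I §2.4] -/
theorem absGaloisRestrict_eq_conj_inner (s : absoluteGaloisGroup F₀) :
    absGaloisRestrict K₀ F₀ s =
      absGaloisRestrict K₀ F₀ γ₀ *
        ((absGaloisRestrict K₀ F₀).comp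
          (⟨(MulAut.conj γ₀⁻¹).toMonoidHom, (continuous_const.mul continuous_id).mul continuous_const⟩ :
            absoluteGaloisGroup F₀ →ₜ* absoluteGaloisGroup F₀)) s * (absGaloisRestrict K₀ F₀ γ₀)⁻¹ := by
  change absGaloisRestrict K₀ F₀ s = absGaloisRestrict K₀ F₀ γ₀ * absGaloisRestrict K₀ F₀ (γ₀⁻¹ * s * γ₀⁻¹⁻¹) * (absGaloisRestrict K₀ F₀ γ₀)⁻¹
  rw [inv_inv, map_mul, map_mul, map_inv]
  group

omit [CharZero K₀] in
/-- **Inner conjugation does not change `exp*`** (over any `p`-adic field `F₀`): for `γ₀ ∈ Γ_{F₀}` and `η₀ ∈ Z¹(Γ_{F₀}, T_pW)`, the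
conjugated cocycle `s ↦ T(γ₀) η₀(γ₀⁻¹ s γ₀)` equals `η₀(s) + (s − 1)·η₀(γ₀)`, a cohomologous cocycle, so its `exp*_{ω₀}` is that of `η₀`
(`dualExpCoord_congr_coboundary`). [cite: SerreGaloisCohomology1997, I §5.8 (inner automorphisms act trivially on H¹)] [cite: Kato1993LNM1553, Ch. II §1.2.4] -/
theorem expStarCoord_innerConj [ValuativeRel F₀] [TopologicalSpace F₀] [IsNonarchimedeanLocalField F₀] [CharZero F₀]
    [Fact (¬ IsUnit (p : integerC F₀))] [IsAdicComplete (Ideal.span {(p : integerC F₀)}) (integerC F₀)]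
    (hp₀ : valuation F₀ p < 1) [Algebra ℚ_[p] F₀]
    (d₀ : (bdRPeriodRingData (F := F₀) (p := p) hp₀).FilZeroLine (restrictedRationalTateRep W F₀ p))
    (η₀ : contOneCocycles (restrictedTateRep W F₀ p).toTopRep) :
    expStarCoord W hp₀ d₀
        (contOneCocycles.pullback
          (⟨(MulAut.conj γ₀⁻¹).toMonoidHom, (continuous_const.mul continuous_id).mul continuous_const⟩ :
            absoluteGaloisGroup F₀ →ₜ* absoluteGaloisGroup F₀)
          ((W.tateGaloisRep p (W.continuous_galoisRepTate_holds p)).toIntRep.restrictConjHom _ (absGaloisRestrict K₀ F₀)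
            (absGaloisRestrict K₀ F₀ γ₀) (absGaloisRestrict_eq_conj_inner F₀ γ₀)) η₀) =
      expStarCoord W hp₀ d₀ η₀ := by
  unfold expStarCoord
  refine dualExpCoord_congr_coboundary (TateModule.toRational p (η₀.1 γ₀)) fun s => ?_
  rw [contOneCocycles.pullback_apply]
  change TateModule.toRational p ((W.tateGaloisRep p (W.continuous_galoisRepTate_holds p)).toIntRep (absGaloisRestrict K₀ F₀ γ₀)
      (η₀.1 (γ₀⁻¹ * s * γ₀⁻¹⁻¹))) = _
  rw [inv_inv]
  have h := contOneCocycles.apply_smul_inv_mul η₀ γ₀ (s * γ₀)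
  rw [← mul_assoc, η₀.2 s γ₀] at h
  change (W.tateGaloisRep p (W.continuous_galoisRepTate_holds p)).toIntRep (absGaloisRestrict K₀ F₀ γ₀) (η₀.1 (γ₀⁻¹ * s * γ₀)) =
    η₀.1 s + (restrictedTateRep W F₀ p) s (η₀.1 γ₀) - η₀.1 γ₀ at h
  rw [h, add_sub_assoc, map_add, map_sub]
  congr 2

variable (ĝ : AlgebraicClosure F ≃ₐ[K₀] AlgebraicClosure F)
  {α : absoluteGaloisGroup F ≃ₜ* absoluteGaloisGroup F}
  (hα : ∀ (σ : absoluteGaloisGroup F) (x : AlgebraicClosure F), α σ • ĝ x = ĝ (σ • x))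
  {τ : absoluteGaloisGroup K₀}
  (hτ : ∀ x : AlgebraicClosure K₀, absClosureEmbedding K₀ F (τ • x) = ĝ (absClosureEmbedding K₀ F x))
  (hconj : ∀ σ : absoluteGaloisGroup F,
    absGaloisRestrict K₀ F σ =
      τ * ((absGaloisRestrict K₀ F).comp (α.symm : absoluteGaloisGroup F →ₜ* absoluteGaloisGroup F)) σ * τ⁻¹)
  (hγ₀ : ∀ y : AlgebraicClosure F₀, ĝ (absClosureEmbedding F₀ F y) = absClosureEmbedding F₀ F (γ₀ • y))
  {τ₀ : absoluteGaloisGroup K₀}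
  (hτ₀ : ∀ x : AlgebraicClosure K₀, absClosureEmbedding F₀ F (absClosureEmbedding K₀ F₀ x) = absClosureEmbedding K₀ F (τ₀ • x))
  (hconj₀ : ∀ σ : absoluteGaloisGroup F,
    absGaloisRestrict K₀ F σ = τ₀ * ((absGaloisRestrict K₀ F₀).comp (absGaloisRestrict F₀ F)) σ * τ₀⁻¹)

omit [CharZero K₀] [W.IsElliptic] [IsScalarTower K₀ F₀ F] in
include hα hτ hγ₀ hτ₀ in
/-- **`Conj (Res η₀) = Res (γ₀ · η₀)` on the nose**: `τ • τ₀ • η₀(res(α⁻¹ σ)) = τ₀ • T(γ₀) • η₀(γ₀⁻¹ res(σ) γ₀)` (§2: `res(α⁻¹σ) = γ₀⁻¹ res(σ) γ₀`,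
`τ τ₀ = τ₀ res₀(γ₀)`). [cite: SerreGaloisCohomology1997, I §2.4 and §5.8] -/
theorem outerConj_res_eq_res_innerConj (η₀ : contOneCocycles (restrictedTateRep W F₀ p).toTopRep) :
    contOneCocycles.pullback (α.symm : absoluteGaloisGroup F →ₜ* absoluteGaloisGroup F)
        ((W.tateGaloisRep p (W.continuous_galoisRepTate_holds p)).toIntRep.restrictConjHom
          ((absGaloisRestrict K₀ F).comp (α.symm : absoluteGaloisGroup F →ₜ* absoluteGaloisGroup F))
          (absGaloisRestrict K₀ F) τ hconj)
        (contOneCocycles.pullback (absGaloisRestrict F₀ F)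
          ((W.tateGaloisRep p (W.continuous_galoisRepTate_holds p)).toIntRep.restrictConjHom
            ((absGaloisRestrict K₀ F₀).comp (absGaloisRestrict F₀ F)) (absGaloisRestrict K₀ F) τ₀ hconj₀) η₀) =
      contOneCocycles.pullback (absGaloisRestrict F₀ F)
        ((W.tateGaloisRep p (W.continuous_galoisRepTate_holds p)).toIntRep.restrictConjHom
          ((absGaloisRestrict K₀ F₀).comp (absGaloisRestrict F₀ F)) (absGaloisRestrict K₀ F) τ₀ hconj₀)
        (contOneCocycles.pullback
          (⟨(MulAut.conj γ₀⁻¹).toMonoidHom, (continuous_const.mul continuous_id).mul continuous_const⟩ :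
            absoluteGaloisGroup F₀ →ₜ* absoluteGaloisGroup F₀)
          ((W.tateGaloisRep p (W.continuous_galoisRepTate_holds p)).toIntRep.restrictConjHom _ (absGaloisRestrict K₀ F₀)
            (absGaloisRestrict K₀ F₀ γ₀) (absGaloisRestrict_eq_conj_inner F₀ γ₀)) η₀) := by
  refine Subtype.ext (ContinuousMap.ext fun σ => ?_)
  rw [contOneCocycles.pullback_apply, contOneCocycles.pullback_apply, contOneCocycles.pullback_apply, contOneCocycles.pullback_apply]
  change τ • (τ₀ • η₀.1 (absGaloisRestrict F₀ F ((α.symm : absoluteGaloisGroup F →ₜ* absoluteGaloisGroup F) σ))) =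
    τ₀ • (absGaloisRestrict K₀ F₀ γ₀ • η₀.1 (γ₀⁻¹ * absGaloisRestrict F₀ F σ * γ₀⁻¹⁻¹))
  rw [inv_inv, ← mul_smul, ← mul_smul, outerEmb_mul_towerEmb F₀ F ĝ hτ hγ₀ hτ₀,
    show (α.symm : absoluteGaloisGroup F →ₜ* absoluteGaloisGroup F) σ = α.symm σ from rfl,
    absGaloisRestrict_outerConj_symm F₀ F ĝ hα hγ₀]

end Inner

/-! ### §4 `exp*` is `Gal(F/F₀)`-equivariant for a generator coming from `F₀` -/

section Main

variable [ValuativeRel F] [TopologicalSpace F] [IsNonarchimedeanLocalField F] [CharZero F]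
  [Fact (¬ IsUnit (p : integerC F))] [IsAdicComplete (Ideal.span {(p : integerC F)}) (integerC F)]
  (hp : valuation F p < 1) [Algebra ℚ_[p] F]
  [ValuativeRel F₀] [TopologicalSpace F₀] [IsNonarchimedeanLocalField F₀] [CharZero F₀]
  [Fact (¬ IsUnit (p : integerC F₀))] [IsAdicComplete (Ideal.span {(p : integerC F₀)}) (integerC F₀)]
  (hp₀ : valuation F₀ p < 1) [Algebra ℚ_[p] F₀]
  (g : F ≃ₐ[K₀] F) (ĝ : AlgebraicClosure F ≃ₐ[K₀] AlgebraicClosure F)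
  (hĝ : ∀ c : F, ĝ (algebraMap F (AlgebraicClosure F) c) = algebraMap F (AlgebraicClosure F) (g c))
  {α : absoluteGaloisGroup F ≃ₜ* absoluteGaloisGroup F}
  (hα : ∀ (σ : absoluteGaloisGroup F) (x : AlgebraicClosure F), α σ • ĝ x = ĝ (σ • x))
  {τ : absoluteGaloisGroup K₀}
  (hτ : ∀ x : AlgebraicClosure K₀, absClosureEmbedding K₀ F (τ • x) = ĝ (absClosureEmbedding K₀ F x))
  (hconj : ∀ σ : absoluteGaloisGroup F,
    absGaloisRestrict K₀ F σ =
      τ * ((absGaloisRestrict K₀ F).comp (α.symm : absoluteGaloisGroup F →ₜ* absoluteGaloisGroup F)) σ * τ⁻¹)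
  {gτ : W.rationalTateModule p ≃ₗ[ℚ_[p]] W.rationalTateModule p}
  (hgτ : ∀ m, gτ m = (W.rationalTateGaloisRep p (W.continuous_rationalGaloisRepTate_holds p)) τ m)
  {γ₀ : absoluteGaloisGroup F₀}
  (hγ₀ : ∀ y : AlgebraicClosure F₀, ĝ (absClosureEmbedding F₀ F y) = absClosureEmbedding F₀ F (γ₀ • y))
  {τ₀ : absoluteGaloisGroup K₀}
  (hτ₀ : ∀ x : AlgebraicClosure K₀, absClosureEmbedding F₀ F (absClosureEmbedding K₀ F₀ x) = absClosureEmbedding K₀ F (τ₀ • x))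
  (hconj₀ : ∀ σ : absoluteGaloisGroup F,
    absGaloisRestrict K₀ F σ = τ₀ * ((absGaloisRestrict K₀ F₀).comp (absGaloisRestrict F₀ F)) σ * τ₀⁻¹)

omit [CharZero K₀] [IsScalarTower K₀ F₀ F] in
include hĝ hα hτ hconj hgτ hγ₀ hτ₀ in
/-- ★★ **`exp*_ω(Conj η) = g(exp*_ω(η))` for every `η ∈ Z¹(Γ_F, T_pW|_{Γ_F})`, when the generator `ω` comes from `F₀`.** Hypotheses: the
Prop-1.2.3 binders of `V_pW|_{Γ_F}`; a generator `d₀` over `F₀` and `d` over `F` with the compatibility clause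
`exp*_d(Res η₀) = (F₀ → F)(exp*_{d₀}(η₀))` for all `η₀` (hT₂ / [REC-tower]'s `hcomp`, read on the direct representation); ONE `η₀` with
`exp*_{d₀}(η₀) ≠ 0`. Proof: the transported generator `d''` of `exists_filZeroLine_expStarCoord_outerConj` is `λ • d.ω`; at `η = Res η₀`:
`g(exp*_d(Res η₀)) = exp*_{d₀}(η₀)|_F` (`g` fixes `F₀`) while `exp*_{d''}(Conj (Res η₀)) = λ⁻¹ exp*_d(Res (γ₀·η₀)) = λ⁻¹ exp*_{d₀}(η₀)|_F`
(§3), so `λ = 1`. [cite: Kato1993LNM1553, Ch. II §1.2.4 and Prop. 1.2.3] [cite: SerreGaloisCohomology1997, I §5.8] -/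
theorem expStarCoord_outerConj
    (hinj : (bdRPeriodRingData (F := F) (p := p) hp).CupLogInjective (logCyclotomic p) (restrictedRationalTateRep W F p))
    (hde : ∀ z : contOneCocycles (restrictedRationalTateRep W F p).toTopRep,
      (bdRPeriodRingData (F := F) (p := p) hp).HasDualExp (logCyclotomic p) (restrictedRationalTateRep W F p) fun σ => z.1 σ)
    (d₀ : (bdRPeriodRingData (F := F₀) (p := p) hp₀).FilZeroLine (restrictedRationalTateRep W F₀ p))
    (d : (bdRPeriodRingData (F := F) (p := p) hp).FilZeroLine (restrictedRationalTateRep W F p))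
    (hcomp : ∀ η₀ : contOneCocycles (restrictedTateRep W F₀ p).toTopRep,
      expStarCoord W hp d
          (contOneCocycles.pullback (absGaloisRestrict F₀ F)
            ((W.tateGaloisRep p (W.continuous_galoisRepTate_holds p)).toIntRep.restrictConjHom
              ((absGaloisRestrict K₀ F₀).comp (absGaloisRestrict F₀ F)) (absGaloisRestrict K₀ F) τ₀ hconj₀) η₀) =
        algebraMap F₀ F (expStarCoord W hp₀ d₀ η₀))
    (hne : ∃ η₀ : contOneCocycles (restrictedTateRep W F₀ p).toTopRep, expStarCoord W hp₀ d₀ η₀ ≠ 0)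
    (η : contOneCocycles (restrictedTateRep W F p).toTopRep) :
    expStarCoord W hp d
        (contOneCocycles.pullback (α.symm : absoluteGaloisGroup F →ₜ* absoluteGaloisGroup F)
          ((W.tateGaloisRep p (W.continuous_galoisRepTate_holds p)).toIntRep.restrictConjHom
            ((absGaloisRestrict K₀ F).comp (α.symm : absoluteGaloisGroup F →ₜ* absoluteGaloisGroup F))
            (absGaloisRestrict K₀ F) τ hconj) η) =
      g (expStarCoord W hp d η) := by
  obtain ⟨d'', hd''⟩ := exists_filZeroLine_expStarCoord_outerConj W F hp g ĝ hĝ hα hconj hgτ hinj hde d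
  -- `d''.ω = lam • d.ω`
  obtain ⟨lam, hlam⟩ := d.exists_smul_eq d''.ω d''.mem_D d''.mem_filTensor
  have hlam0 : lam ≠ 0 := fun h => d''.ne_zero (by rw [hlam, h, zero_smul])
  have hscale : ∀ z : contOneCocycles (restrictedTateRep W F p).toTopRep,
      expStarCoord W hp d'' z = lam⁻¹ * expStarCoord W hp d z := fun z => by
    unfold expStarCoord
    rw [hlam]
    exact FilZeroLine.dualExpCoord_smul d hlam0 _
  -- the test cocycle `Res η₀` with `exp*_{d₀} η₀ ≠ 0`
  obtain ⟨η₀, hη₀⟩ := hne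
  have hgF₀ : ∀ c : F₀, g (algebraMap F₀ F c) = algebraMap F₀ F c := algEquiv_algebraMap_of_inner F₀ F g ĝ hĝ hγ₀
  have e1 := hd'' (contOneCocycles.pullback (absGaloisRestrict F₀ F)
    ((W.tateGaloisRep p (W.continuous_galoisRepTate_holds p)).toIntRep.restrictConjHom
      ((absGaloisRestrict K₀ F₀).comp (absGaloisRestrict F₀ F)) (absGaloisRestrict K₀ F) τ₀ hconj₀) η₀)
  have e2 := hscale (contOneCocycles.pullback (α.symm : absoluteGaloisGroup F →ₜ* absoluteGaloisGroup F)
    ((W.tateGaloisRep p (W.continuous_galoisRepTate_holds p)).toIntRep.restrictConjHom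
      ((absGaloisRestrict K₀ F).comp (α.symm : absoluteGaloisGroup F →ₜ* absoluteGaloisGroup F))
      (absGaloisRestrict K₀ F) τ hconj)
    (contOneCocycles.pullback (absGaloisRestrict F₀ F)
      ((W.tateGaloisRep p (W.continuous_galoisRepTate_holds p)).toIntRep.restrictConjHom
        ((absGaloisRestrict K₀ F₀).comp (absGaloisRestrict F₀ F)) (absGaloisRestrict K₀ F) τ₀ hconj₀) η₀))
  have e3 := congrArg (expStarCoord W hp d) (outerConj_res_eq_res_innerConj W F₀ F p γ₀ ĝ hα hτ hconj hγ₀ hτ₀ hconj₀ η₀)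
  have e5 := expStarCoord_innerConj W F₀ p γ₀ hp₀ d₀ η₀
  -- `lam⁻¹ · a = a` with `a ≠ 0`, so `lam = 1`
  have ha : algebraMap F₀ F (expStarCoord W hp₀ d₀ η₀) ≠ 0 := (map_ne_zero _).mpr hη₀
  have hA : _ = algebraMap F₀ F (expStarCoord W hp₀ d₀ η₀) := e1.trans (by rw [hcomp η₀, hgF₀])
  have hB : _ = lam⁻¹ * algebraMap F₀ F (expStarCoord W hp₀ d₀ η₀) :=
    e2.trans (congrArg (lam⁻¹ * ·) (e3.trans ((hcomp _).trans (congrArg (algebraMap F₀ F) e5))))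
  have key : lam⁻¹ * algebraMap F₀ F (expStarCoord W hp₀ d₀ η₀) = algebraMap F₀ F (expStarCoord W hp₀ d₀ η₀) := hB.symm.trans hA
  have hlam1 : lam = 1 := by
    have h := mul_right_cancel₀ ha (key.trans (one_mul _).symm)
    exact inv_eq_one.mp h
  -- conclude
  have hω : d''.ω = d.ω := by rw [hlam, hlam1, one_smul]
  have := hd'' η
  unfold expStarCoord at this ⊢
  rw [hω] at this
  exact this

end Main

end Summit.BirchSwinnertonDyer.BirchSwinnertonDyer.Theorems.StarredOptimalManinUnitFiveSevenDualExpOuterGaloisInvariant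

end
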